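import Mathlib.NumberTheory.NumberField.Basic
import Mathlib.RingTheory.DedekindDomain.Different
import Mathlib.FieldTheory.Minpoly.IsIntegrallyClosed
import HarnessLib

/-!
# A prime not dividing `4m` is unramified in `F(√m) / F`

Topic `NumberTheory/NumberFields`.  Theorem-only file (no definition, no named fact).

Let `F ⊆ E` be number fields with `E = F(x)`, `x ∈ 𝓞_E`, `x² = m` (`m` an integer of `F`).  Then
the polynomial `g = X² − m` kills `x`, so the minimal polynomial of `x` over `𝓞_F` divides `g` and
`g'(x) = 2x` lies in the different `𝔇(𝓞_E/𝓞_F)` (Mathlib: `aeval_derivative_mem_differentIdeal`,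
the inclusion `f'(x) ∈ 𝔇` for a generating algebraic integer).  Consequently a prime `𝔔` of `𝓞_E`
with `4m ∉ 𝔔` cannot divide the different, i.e. it is **unramified** over `𝓞_F`
(`dvd_differentIdeal_iff`): `isUnramifiedAt_of_sq_eq`.  The same over `ℤ`
(`isUnramifiedAt_int_of_sq_eq`): a prime of `𝓞_K`, `K = ℚ(x)`, `x² = m ∈ ℤ`, not containing `4m`
is unramified over `ℤ` — the elementary half of "the ramified primes of `ℚ(√m)` divide `4m`".

This is the classical different/discriminant bound `𝔇 ∣ (f'(x))` (Neukirch, *Algebraic Number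
Theory*, Ch. III (2.4)–(2.6); Hecke, *Vorlesungen*, §36/§38) specialised to square roots; it is
the form in which the at-`3` analysis of the Scholz–Hecke unit criterion
(`Literature/NumberTheory/QuadraticFields/ScholzHeckeUnitCriterion*.lean`) needs it.

## References

* J. Neukirch, *Algebraic Number Theory*, Grundlehren 322, Springer 1999, Ch. III §2,
  (2.4)–(2.6). [NeukirchANT1999]
* E. Hecke, *Lectures on the Theory of Algebraic Numbers*, GTM 77, Springer 1981, §36 and §38.
  [Hecke1981]
-/

noncomputable section

open NumberField Polynomial

namespace Literature.NumberTheory.NumberFields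

/-- **A prime not dividing `4m` is unramified in `F(√m)/F`.**  Let `F ⊆ E` be number fields,
`x ∈ 𝓞_E` with `x² = m` (`m ∈ 𝓞_F`) and `E = F(x)`.  If `𝔔` is a prime of `𝓞_E` with `4m ∉ 𝔔`,
then `𝔔` is unramified over `𝓞_F`: otherwise `𝔔 ∣ 𝔇(𝓞_E/𝓞_F) ∋ 2x`, so `4m = (2x)² ∈ 𝔔`.
[cite: NeukirchANT1999, Ch. III (2.6)] -/
theorem isUnramifiedAt_of_sq_eq {F E : Type*} [Field F] [NumberField F] [Field E] [NumberField E]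
    [Algebra F E] {x : 𝓞 E} {m : 𝓞 F} (hx : x ^ 2 = algebraMap (𝓞 F) (𝓞 E) m)
    (hgen : Algebra.adjoin F {(x : E)} = ⊤) (Q : Ideal (𝓞 E)) [Q.IsPrime]
    (hQ : algebraMap (𝓞 F) (𝓞 E) (4 * m) ∉ Q) : Algebra.IsUnramifiedAt (𝓞 F) Q := by
  by_contra hram
  have hdvd : Q ∣ differentIdeal (𝓞 F) (𝓞 E) := dvd_differentIdeal_iff.mpr hram
  have hg : aeval x (X ^ 2 - C m : (𝓞 F)[X]) = 0 := by
    simp only [map_sub, aeval_X_pow, aeval_C, hx, sub_self]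
  -- `g'(x) = 2x ∈ 𝔇`: the minimal polynomial of `x` divides `g = X² − m`
  have hD := aeval_derivative_mem_differentIdeal (𝓞 F) F E x hgen
  have hxint : IsIntegral (𝓞 F) x := Algebra.IsIntegral.isIntegral x
  obtain ⟨h, hh⟩ := minpoly.isIntegrallyClosed_dvd hxint hg
  have hmem : aeval x (derivative (X ^ 2 - C m : (𝓞 F)[X])) ∈ differentIdeal (𝓞 F) (𝓞 E) := by
    have hder : aeval x (derivative (X ^ 2 - C m : (𝓞 F)[X])) =
        aeval x (derivative (minpoly (𝓞 F) x)) * aeval x h := by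
      conv_lhs => rw [hh]
      rw [derivative_mul, map_add, map_mul, map_mul, minpoly.aeval, zero_mul, add_zero]
    rw [hder]
    exact Ideal.mul_mem_right _ _ hD
  have hval : aeval x (derivative (X ^ 2 - C m : (𝓞 F)[X])) = 2 * x := by
    rw [derivative_sub, derivative_C, sub_zero, derivative_X_pow, map_mul, aeval_C, map_pow,
      aeval_X, map_natCast]
    norm_num
  rw [hval] at hmem
  have h2x : 2 * x ∈ Q := (Ideal.le_of_dvd hdvd) hmem
  apply hQ
  have : algebraMap (𝓞 F) (𝓞 E) (4 * m) = (2 * x) * (2 * x) := by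
    rw [map_mul, map_ofNat, ← hx]; ring
  rw [this]
  exact Q.mul_mem_left _ h2x

/-- **A prime not dividing `4m` is unramified in `ℚ(√m)/ℚ`** (the same over `ℤ`).  Let `K` be a
number field, `x ∈ 𝓞_K` with `x² = m ∈ ℤ` and `K = ℚ(x)`.  If `𝔭` is a prime of `𝓞_K` with
`4m ∉ 𝔭`, then `𝔭` is unramified over `ℤ`. [cite: NeukirchANT1999, Ch. III (2.6)] -/
theorem isUnramifiedAt_int_of_sq_eq {K : Type*} [Field K] [NumberField K] {x : 𝓞 K} {m : ℤ}
    (hx : x ^ 2 = m) (hgen : Algebra.adjoin ℚ {(x : K)} = ⊤) (P : Ideal (𝓞 K)) [P.IsPrime]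
    (hP : ((4 * m : ℤ) : 𝓞 K) ∉ P) : Algebra.IsUnramifiedAt ℤ P := by
  by_contra hram
  have hdvd : P ∣ differentIdeal ℤ (𝓞 K) := dvd_differentIdeal_iff.mpr hram
  have hg : aeval x (X ^ 2 - C m : ℤ[X]) = 0 := by
    simp only [map_sub, aeval_X_pow, aeval_C, hx, algebraMap_int_eq, Int.coe_castRingHom,
      sub_self]
  have hD := aeval_derivative_mem_differentIdeal ℤ ℚ K x hgen
  have hxint : IsIntegral ℤ x := Algebra.IsIntegral.isIntegral x
  obtain ⟨h, hh⟩ := minpoly.isIntegrallyClosed_dvd hxint hg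
  have hmem : aeval x (derivative (X ^ 2 - C m : ℤ[X])) ∈ differentIdeal ℤ (𝓞 K) := by
    have hder : aeval x (derivative (X ^ 2 - C m : ℤ[X])) =
        aeval x (derivative (minpoly ℤ x)) * aeval x h := by
      conv_lhs => rw [hh]
      rw [derivative_mul, map_add, map_mul, map_mul, minpoly.aeval, zero_mul, add_zero]
    rw [hder]
    exact Ideal.mul_mem_right _ _ hD
  have hval : aeval x (derivative (X ^ 2 - C m : ℤ[X])) = 2 * x := by
    rw [derivative_sub, derivative_C, sub_zero, derivative_X_pow, map_mul, aeval_C, map_pow,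
      aeval_X, map_natCast]
    norm_num
  rw [hval] at hmem
  have h2x : 2 * x ∈ P := (Ideal.le_of_dvd hdvd) hmem
  apply hP
  have : ((4 * m : ℤ) : 𝓞 K) = (2 * x) * (2 * x) := by
    push_cast
    rw [← hx]; ring
  rw [this]
  exact P.mul_mem_left _ h2x

end Literature.NumberTheory.NumberFields
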